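import Mathlib.Analysis.SpecialFunctions.ContinuousFunctionalCalculus.ExpLog.Order
import Mathlib.Analysis.CStarAlgebra.Matrix
import Mathlib.Analysis.Matrix.Order
import Mathlib.Tactic.Module
import Mathlib.Tactic.NoncommRing
import Literature.LinearAlgebra.Matrix.HermitianCfcDiagonalForm
import HarnessLib

/-!
# Jensen's operator inequality for an isometry (Hansen–Pedersen) and the matrix logarithm:
# `V* (log Δ) V ≤ log (V* Δ V)`

Topic `LinearAlgebra/Matrix`, namespace `Literature.LinearAlgebra.Matrix`.

For an operator concave function `f` on an interval `I`, an isometry `v` (`v* v = 1`) and a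
self-adjoint `x` with spectrum in `I`, JENSEN'S OPERATOR INEQUALITY reads `v* f(x) v ≤ f(v* x v)`
[cite: HansenPedersen2003, Theorem 2.1 (iii)] (stated there for operator CONVEX `f` with `≥`; the
concave form is the same statement for `-f`), the non-commutative form of Jensen's inequality of
[cite: HansenPedersen1982, Theorem 2.1].  We prove it for complex matrices, for an isometry
`V : Matrix N M ℂ` (`Vᴴ V = 1`) between possibly different index types, for every real function
`f` whose matrix function `A ↦ f(A) = cfc f A` is MIDPOINT operator concave on the positive definite
matrices (the matrix form [cite: Petz2008, Theorem 11.21 eq. (11.52)] with `n = 1`), and we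
specialise it to the logarithm, whose operator concavity [cite: Petz2008, §11.6 eq. (11.51) and the
remark after Example 11.24] is Mathlib's `CFC.concaveOn_log`.  The logarithmic instance
`Vᴴ (log Δ) V ≤ log (Vᴴ Δ V)` for positive definite `Δ` is the operator inequality behind the
monotonicity of the quantum relative entropy under partial traces in Petz's relative-modular-operator
proof [cite: Petz2008, Theorem 3.10, eqs. (3.24)–(3.26)], which is its consumer in this tree
(`Literature/InformationTheory/Entropy/`).

## Proof (Hansen–Pedersen's unitary-reflection argument, finite-dimensional form)

With `P = V Vᴴ` the range projection of the isometry and the self-adjoint unitary `U = 2P − 1`,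
`½ (Y + U Y U) = P Y P + (1−P) Y (1−P)` for every `Y` (the "pinching" by `P`: the `n = 2`,
`θ = −1` case of the roots-of-unity averaging [cite: HansenPedersen2003, Lemma 3.1],
[cite: Petz2008, proof of Theorem 11.21]); midpoint concavity at
the pair `Δ, U Δ U` together with the unitary covariance `f(U Δ U) = U f(Δ) U` gives
`P f(Δ) P + (1−P) f(Δ) (1−P) ≤ f(P Δ P + (1−P) Δ (1−P))`; compressing with `Vᴴ · V` (which preserves
the Löwner order, kills the `1−P` corner and fixes the `P` corner) and using that the functional
calculus commutes with the compression of an operator REDUCED by `P`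
(`Vᴴ f(X) V = f(Vᴴ X V)` when `X P = P X`, proved by Lagrange interpolation of `f` on the two finite
spectra and the identity `Vᴴ Xᵏ V = (Vᴴ X V)ᵏ`) yields `Vᴴ f(Δ) V ≤ f(Vᴴ Δ V)`.
[cite: HansenPedersen2003, §1 eq. (2) and proof of Theorem 2.1]

## Contents (all PROVED; no definition, no named fact)

* `conjTranspose_mul_pow_mul_of_isometry`, `conjTranspose_mul_aeval_mul_of_isometry`,
  **`conjTranspose_mul_cfc_mul_of_isometry`** — compression by an isometry whose range reduces `X`
  commutes with powers, polynomials and the functional calculus of `X`;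
* `conjTranspose_mul_cfc_mul_of_unitary` — unitary covariance `Uᴴ f(X) U = f(Uᴴ X U)`;
* **`conjTranspose_mul_cfc_mul_le_cfc_of_midpoint_concave`** — Jensen's operator inequality for an
  isometry and a midpoint operator concave matrix function on positive definite matrices;
* **`conjTranspose_mul_log_mul_le_log`** — the logarithmic instance `Vᴴ (log Δ) V ≤ log (Vᴴ Δ V)`,
  with the quadratic-form corollary `re_star_dotProduct_log_mulVec_le`.

## References

* F. Hansen, G. K. Pedersen, *Jensen's operator inequality*, Bull. London Math. Soc. 35 (2003)
  553–564, Theorem 2.1. [HansenPedersen2003]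
* F. Hansen, G. K. Pedersen, *Jensen's inequality for operators and Löwner's theorem*, Math. Ann.
  258 (1982) 229–241. [HansenPedersen1982]
* D. Petz, *Quantum Information Theory and Quantum Statistics* (Springer 2008), §11.2 (Löwner
  order under `X · X*`), §11.6 (operator convexity (11.51), Jensen's operator inequality
  Theorem 11.21 (11.52), operator concavity of `log` after Example 11.24), Theorem 3.10 (the
  consumer: monotonicity of quasi-entropies). [Petz2008]

## Mathlib

`CFC.concaveOn_log` (operator concavity of `log` in a unital C⋆-algebra, here `Matrix N N ℂ` with
the `L²`-operator norm, `open scoped Matrix.Norms.L2Operator`), `Matrix.PosDef.isStrictlyPositive`,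
the Löwner order `Matrix.le_iff` (`open scoped MatrixOrder`), `cfc_polynomial` (through the tree's
`cfc_eq_aeval_of_eval_eq` / `exists_polynomial_eval_eq`).
-/

noncomputable section

open Matrix Polynomial
open scoped MatrixOrder ComplexOrder

namespace Literature.LinearAlgebra.Matrix

variable {𝕜 : Type*} [RCLike 𝕜] {N M : Type*} [Fintype N] [Fintype M] [DecidableEq N]
  [DecidableEq M]

/-! ### Compression by an isometry whose range reduces the operator -/

omit [DecidableEq N] in
/-- An isometry `V` (`Vᴴ V = 1`) is injective on vectors (`x = Vᴴ V x`). [cite: Petz2008, §11.1] -/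
theorem mulVec_injective_of_isometry (V : Matrix N M 𝕜) (hV : Vᴴ * V = 1) :
    Function.Injective V.mulVec := by
  intro x y h
  have h' := congrArg (Vᴴ.mulVec) h
  simpa only [Matrix.mulVec_mulVec, hV, Matrix.one_mulVec] using h'

/-- For an isometry `V` (`Vᴴ V = 1`) whose range projection `P = V Vᴴ` commutes with `X`
(i.e. the range of `V` reduces `X`), compression commutes with powers:
`Vᴴ Xᵏ V = (Vᴴ X V)ᵏ`. [cite: HansenPedersen2003, §1 eq. (2)] -/
theorem conjTranspose_mul_pow_mul_of_isometry (V : Matrix N M 𝕜) (hV : Vᴴ * V = 1)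
    {X : Matrix N N 𝕜} (hX : X * (V * Vᴴ) = V * Vᴴ * X) (k : ℕ) :
    Vᴴ * X ^ k * V = (Vᴴ * X * V) ^ k := by
  induction k with
  | zero => simp [hV]
  | succ k ih =>
    have hPV : V * Vᴴ * V = V := by rw [Matrix.mul_assoc, hV, Matrix.mul_one]
    rw [pow_succ, pow_succ, ← ih]
    calc Vᴴ * (X ^ k * X) * V = Vᴴ * X ^ k * (X * (V * Vᴴ * V)) := by
          rw [hPV]; simp only [Matrix.mul_assoc]
      _ = Vᴴ * X ^ k * (X * (V * Vᴴ) * V) := by simp only [Matrix.mul_assoc]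
      _ = Vᴴ * X ^ k * (V * Vᴴ * X * V) := by rw [hX]
      _ = Vᴴ * X ^ k * V * (Vᴴ * X * V) := by simp only [Matrix.mul_assoc]

/-- Compression by an isometry whose range reduces `X` commutes with the polynomial functional
calculus: `Vᴴ p(X) V = p(Vᴴ X V)` for every real polynomial `p`.
[cite: HansenPedersen2003, §1 eq. (2)] -/
theorem conjTranspose_mul_aeval_mul_of_isometry (V : Matrix N M 𝕜) (hV : Vᴴ * V = 1)
    {X : Matrix N N 𝕜} (hX : X * (V * Vᴴ) = V * Vᴴ * X) (p : ℝ[X]) :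
    Vᴴ * aeval X p * V = aeval (Vᴴ * X * V) p := by
  induction p using Polynomial.induction_on' with
  | add p q hp hq => simp only [map_add, Matrix.mul_add, Matrix.add_mul, hp, hq]
  | monomial k a =>
    simp only [aeval_monomial, Algebra.algebraMap_eq_smul_one, smul_mul_assoc, one_mul,
      Matrix.mul_smul, Matrix.smul_mul, conjTranspose_mul_pow_mul_of_isometry V hV hX k]

/-- **The functional calculus commutes with the compression of a reduced operator**: for an
isometry `V` (`Vᴴ V = 1`), a Hermitian `X` commuting with the range projection `V Vᴴ`, and every
`f : ℝ → ℝ`, `Vᴴ f(X) V = f(Vᴴ X V)` — Davis' characterisation of spectral functions,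
`F(y ⊕ z) = F(y) ⊕ F(z)` for `x = y + z` reduced by a projection, read on the range of `V`.
Proof: interpolate `f` by one polynomial on the union of the two finite spectra.
[cite: HansenPedersen2003, §1 eq. (2)] -/
theorem conjTranspose_mul_cfc_mul_of_isometry (V : Matrix N M 𝕜) (hV : Vᴴ * V = 1)
    {X : Matrix N N 𝕜} (hXh : X.IsHermitian) (hX : X * (V * Vᴴ) = V * Vᴴ * X) (f : ℝ → ℝ) :
    Vᴴ * cfc f X * V = cfc f (Vᴴ * X * V) := by
  have hY : (Vᴴ * X * V).IsHermitian := isHermitian_conjTranspose_mul_mul V hXh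
  obtain ⟨p, hp⟩ := exists_polynomial_eval_eq (spectrum ℝ X ∪ spectrum ℝ (Vᴴ * X * V))
    (Matrix.finite_real_spectrum.union Matrix.finite_real_spectrum) f
  rw [cfc_eq_aeval_of_eval_eq hXh f p (fun x hx => hp x (Set.mem_union_left _ hx)),
    cfc_eq_aeval_of_eval_eq hY f p (fun x hx => hp x (Set.mem_union_right _ hx)),
    conjTranspose_mul_aeval_mul_of_isometry V hV hX p]

/-- **Unitary covariance of the functional calculus**: `Uᴴ f(X) U = f(Uᴴ X U)` for a unitary `U`
(`Uᴴ U = 1`) and Hermitian `X`. [cite: HansenPedersen2003, §1 eq. (2)] -/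
theorem conjTranspose_mul_cfc_mul_of_unitary (U : Matrix N N 𝕜) (hU : Uᴴ * U = 1)
    {X : Matrix N N 𝕜} (hXh : X.IsHermitian) (f : ℝ → ℝ) :
    Uᴴ * cfc f X * U = cfc f (Uᴴ * X * U) := by
  have hUU : U * Uᴴ = 1 := mul_eq_one_comm.mp hU
  exact conjTranspose_mul_cfc_mul_of_isometry U hU hXh (by rw [hUU, Matrix.mul_one, Matrix.one_mul]) f

/-! ### Jensen's operator inequality for an isometry -/

omit [DecidableEq N] [DecidableEq M] in
/-- The Löwner order is preserved by compressions: `A ≤ B → Vᴴ A V ≤ Vᴴ B V` ("the inequality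
`A ≤ B` implies `X A X* ≤ X B X*` for every operator `X`"). [cite: Petz2008, §11.2] -/
theorem conjTranspose_mul_mul_mono (V : Matrix N M 𝕜) {A B : Matrix N N 𝕜} (h : A ≤ B) :
    Vᴴ * A * V ≤ Vᴴ * B * V := by
  rw [Matrix.le_iff] at h ⊢
  simpa only [Matrix.mul_sub, Matrix.sub_mul] using h.conjTranspose_mul_mul_same V

omit [Fintype M] [DecidableEq M] in
/-- The pinching identity behind Hansen–Pedersen's proof: for any `P` and the reflection
`U = 2P − 1`, `½ (Y + U Y U) = P Y P + (1 − P) Y (1 − P)` (for a projection `P` this is the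
pinching of `Y` by `P`; the `n = 2` case of the roots-of-unity averaging).
[cite: HansenPedersen2003, Lemma 3.1] [cite: Petz2008, proof of Theorem 11.21] -/
theorem half_smul_add_half_smul_reflection_conj (P Y : Matrix N N 𝕜) :
    (2⁻¹ : 𝕜) • Y + (2⁻¹ : 𝕜) • (((2 : 𝕜) • P - 1) * Y * ((2 : 𝕜) • P - 1)) =
      P * Y * P + (1 - P) * Y * (1 - P) := by
  have h1 : ((2 : 𝕜) • P - 1) * Y * ((2 : 𝕜) • P - 1) =
      (4 : 𝕜) • (P * Y * P) - (2 : 𝕜) • (P * Y) - (2 : 𝕜) • (Y * P) + Y := by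
    simp only [sub_mul, mul_sub, smul_mul_assoc, mul_smul_comm, Matrix.one_mul, Matrix.mul_one,
      smul_sub, smul_smul]
    module
  have h2 : (1 - P) * Y * (1 - P) = Y - P * Y - Y * P + P * Y * P := by noncomm_ring
  rw [h1, h2]
  module

omit [Fintype M] [DecidableEq M] in
/-- The reflection `U = 2P − 1` through a projection (`P² = P`) squares to the identity (it is the
`n = 2` unitary `E = diag(θ, 1)`, `θ = −1`, of the roots-of-unity averaging in the range/kernel
decomposition of `P`). [cite: HansenPedersen2003, Lemma 3.1] -/
theorem reflection_mul_self {P : Matrix N N 𝕜} (hP : P * P = P) :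
    ((2 : 𝕜) • P - 1) * ((2 : 𝕜) • P - 1) = 1 := by
  simp only [sub_mul, mul_sub, smul_mul_assoc, mul_smul_comm, Matrix.one_mul, Matrix.mul_one,
    smul_sub, smul_smul, hP]
  module

/-- **Jensen's operator inequality for an isometry** (Hansen–Pedersen, concave form): if the matrix
function `A ↦ f(A)` is midpoint operator concave on the positive definite `N × N` complex matrices,
`½ f(A) + ½ f(B) ≤ f(½ A + ½ B)`, then for every isometry `V : ℂᴹ → ℂᴺ` (`Vᴴ V = 1`) and every
positive definite `Δ`, `Vᴴ f(Δ) V ≤ f(Vᴴ Δ V)` in the Löwner order.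
-- TODO(general form): Hansen–Pedersen's Theorem 2.1 is an EQUIVALENCE for functions on an
-- arbitrary interval and unital columns `Σ aᵢ* aᵢ = 1`; here: one isometry, domain = positive
-- definite matrices, midpoint concavity as the hypothesis (sufficient by this very proof).
[cite: HansenPedersen2003, Theorem 2.1 (iii)] [cite: Petz2008, Theorem 11.21 eq. (11.52)] -/
theorem conjTranspose_mul_cfc_mul_le_cfc_of_midpoint_concave (V : Matrix N M ℂ) (hV : Vᴴ * V = 1)
    {f : ℝ → ℝ}
    (hf : ∀ ⦃A B : Matrix N N ℂ⦄, A.PosDef → B.PosDef →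
      (2⁻¹ : ℂ) • cfc f A + (2⁻¹ : ℂ) • cfc f B ≤ cfc f ((2⁻¹ : ℂ) • A + (2⁻¹ : ℂ) • B))
    {Δ : Matrix N N ℂ} (hΔ : Δ.PosDef) :
    Vᴴ * cfc f Δ * V ≤ cfc f (Vᴴ * Δ * V) := by
  -- the range projection `P = V Vᴴ` and the reflection `U = 2P - 1`
  obtain ⟨P, hP⟩ : ∃ P : Matrix N N ℂ, P = V * Vᴴ := ⟨_, rfl⟩
  have hPV : P * V = V := by rw [hP, Matrix.mul_assoc, hV, Matrix.mul_one]
  have hVP : Vᴴ * P = Vᴴ := by rw [hP, ← Matrix.mul_assoc, hV, Matrix.one_mul]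
  have hPP : P * P = P := by
    rw [hP, Matrix.mul_assoc, ← Matrix.mul_assoc Vᴴ, hV, Matrix.one_mul]
  have hPh : Pᴴ = P := by rw [hP, conjTranspose_mul, conjTranspose_conjTranspose]
  obtain ⟨Q, hQ⟩ : ∃ Q : Matrix N N ℂ, Q = 1 - P := ⟨_, rfl⟩
  have hQh : Qᴴ = Q := by rw [hQ, conjTranspose_sub, conjTranspose_one, hPh]
  have hQV : Q * V = 0 := by rw [hQ, Matrix.sub_mul, Matrix.one_mul, hPV, sub_self]
  have hVQ : Vᴴ * Q = 0 := by rw [hQ, Matrix.mul_sub, Matrix.mul_one, hVP, sub_self]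
  have hPQ : P * Q = 0 := by rw [hQ, Matrix.mul_sub, Matrix.mul_one, hPP, sub_self]
  have hQP : Q * P = 0 := by rw [hQ, Matrix.sub_mul, Matrix.one_mul, hPP, sub_self]
  obtain ⟨U, hU⟩ : ∃ U : Matrix N N ℂ, U = (2 : ℂ) • P - 1 := ⟨_, rfl⟩
  have hUh : Uᴴ = U := by
    rw [hU, conjTranspose_sub, conjTranspose_smul, hPh, conjTranspose_one, star_ofNat]
  have hUU : U * U = 1 := by rw [hU]; exact reflection_mul_self hPP
  have hU1 : Uᴴ * U = 1 := by rw [hUh, hUU]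
  have hUinj : Function.Injective U.mulVec := mulVec_injective_of_isometry U hU1
  -- the reflected operator `U Δ U` is positive definite and `f (U Δ U) = U f(Δ) U`
  have hΔ₁ : (U * Δ * U).PosDef := by
    have h := hΔ.conjTranspose_mul_mul_same (B := U) hUinj
    rwa [hUh] at h
  have hcov : cfc f (U * Δ * U) = U * cfc f Δ * U := by
    have h := conjTranspose_mul_cfc_mul_of_unitary U hU1 hΔ.isHermitian f
    rw [hUh] at h
    exact h.symm
  -- midpoint concavity at `Δ, U Δ U`, rewritten as the pinching inequality
  have hconc := hf hΔ hΔ₁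
  rw [hcov, hU, half_smul_add_half_smul_reflection_conj P,
    half_smul_add_half_smul_reflection_conj P, ← hQ] at hconc
  -- compress with `Vᴴ · V`
  have h2 := conjTranspose_mul_mul_mono V hconc
  have lhs : ∀ Y : Matrix N N ℂ, Vᴴ * (P * Y * P + Q * Y * Q) * V = Vᴴ * Y * V := by
    intro Y
    calc Vᴴ * (P * Y * P + Q * Y * Q) * V
        = Vᴴ * P * Y * (P * V) + Vᴴ * Q * Y * (Q * V) := by
          simp only [Matrix.mul_add, Matrix.add_mul, Matrix.mul_assoc]
      _ = Vᴴ * Y * V := by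
          rw [hPV, hVP, hQV, hVQ, Matrix.zero_mul, Matrix.mul_zero, add_zero]
  have hΔ'h : (P * Δ * P + Q * Δ * Q).IsHermitian := by
    have h1 : (P * Δ * P).IsHermitian := by
      simpa only [hPh] using isHermitian_conjTranspose_mul_mul P hΔ.isHermitian
    have h2 : (Q * Δ * Q).IsHermitian := by
      simpa only [hQh] using isHermitian_conjTranspose_mul_mul Q hΔ.isHermitian
    exact h1.add h2
  have hcomm : (P * Δ * P + Q * Δ * Q) * (V * Vᴴ) = V * Vᴴ * (P * Δ * P + Q * Δ * Q) := by
    rw [← hP]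
    calc (P * Δ * P + Q * Δ * Q) * P
        = P * Δ * (P * P) + Q * Δ * (Q * P) := by
          simp only [Matrix.add_mul, Matrix.mul_assoc]
      _ = P * P * Δ * P + P * Q * Δ * Q := by
          rw [hPP, hQP, hPQ, Matrix.mul_zero, Matrix.zero_mul, Matrix.zero_mul, add_zero]
      _ = P * (P * Δ * P + Q * Δ * Q) := by
          simp only [Matrix.mul_add, Matrix.mul_assoc]
  have rhs : Vᴴ * cfc f (P * Δ * P + Q * Δ * Q) * V = cfc f (Vᴴ * Δ * V) := by
    rw [conjTranspose_mul_cfc_mul_of_isometry V hV hΔ'h hcomm f, lhs Δ]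
  rwa [lhs, rhs] at h2

/-! ### The logarithm -/

/-- **Midpoint operator concavity of the matrix logarithm** on positive definite complex matrices:
`½ log A + ½ log B ≤ log (½ A + ½ B)` (`log = cfc Real.log`, Mathlib's `CFC.log`) — Mathlib's
`CFC.concaveOn_log` (Löwner–Heinz), read on `Matrix N N ℂ` with the `L²`-operator-norm
C⋆-structure (`Matrix.Norms.L2Operator`, opened inside the proof only) and with complex scalar
weights. [cite: Petz2008, §11.6 (11.51) and the remark after Example 11.24] -/
theorem half_smul_log_add_half_smul_log_le {A B : Matrix N N ℂ} (hA : A.PosDef) (hB : B.PosDef) :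
    (2⁻¹ : ℂ) • cfc Real.log A + (2⁻¹ : ℂ) • cfc Real.log B ≤
      cfc Real.log ((2⁻¹ : ℂ) • A + (2⁻¹ : ℂ) • B) := by
  open scoped Matrix.Norms.L2Operator in
  exact by
    letI : CStarAlgebra (Matrix N N ℂ) := {}
    have h := (CFC.concaveOn_log (A := Matrix N N ℂ)).2 hA.isStrictlyPositive
      hB.isStrictlyPositive (show (0 : ℝ) ≤ 2⁻¹ by norm_num) (show (0 : ℝ) ≤ 2⁻¹ by norm_num)
      (show (2⁻¹ : ℝ) + 2⁻¹ = 1 by norm_num)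
    change ((2⁻¹ : ℝ) : ℂ) • cfc Real.log A + ((2⁻¹ : ℝ) : ℂ) • cfc Real.log B ≤
      cfc Real.log (((2⁻¹ : ℝ) : ℂ) • A + ((2⁻¹ : ℝ) : ℂ) • B) at h
    have e : ((2⁻¹ : ℝ) : ℂ) = 2⁻¹ := by push_cast; rfl
    rw [e] at h
    exact h

/-- **Jensen's operator inequality for the logarithm**: for an isometry `V : ℂᴹ → ℂᴺ`
(`Vᴴ V = 1`) and a positive definite `Δ`, `Vᴴ (log Δ) V ≤ log (Vᴴ Δ V)` in the Löwner order
(`log = cfc Real.log`).  This is the operator inequality `f(V* Δ V) ≤ V* f(Δ) V`, `f = -log`, of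
Petz's proof of the monotonicity of the relative entropy.
[cite: HansenPedersen2003, Theorem 2.1 (iii)] [cite: Petz2008, Theorem 3.10, eq. (3.26)] -/
theorem conjTranspose_mul_log_mul_le_log (V : Matrix N M ℂ) (hV : Vᴴ * V = 1)
    {Δ : Matrix N N ℂ} (hΔ : Δ.PosDef) :
    Vᴴ * cfc Real.log Δ * V ≤ cfc Real.log (Vᴴ * Δ * V) :=
  conjTranspose_mul_cfc_mul_le_cfc_of_midpoint_concave V hV
    (fun _ _ hA hB => half_smul_log_add_half_smul_log_le hA hB) hΔ

/-- `PosSemidef` spelling of `conjTranspose_mul_log_mul_le_log`: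
`log (Vᴴ Δ V) − Vᴴ (log Δ) V ⪰ 0`. [cite: HansenPedersen2003, Theorem 2.1 (iii)] -/
theorem posSemidef_log_sub_conjTranspose_mul_log_mul (V : Matrix N M ℂ) (hV : Vᴴ * V = 1)
    {Δ : Matrix N N ℂ} (hΔ : Δ.PosDef) :
    (cfc Real.log (Vᴴ * Δ * V) - Vᴴ * cfc Real.log Δ * V).PosSemidef :=
  Matrix.le_iff.mp (conjTranspose_mul_log_mul_le_log V hV hΔ)

omit [DecidableEq N] in
/-- The compression `Vᴴ Δ V` of a positive definite matrix by an isometry is positive definite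
(`x ≠ 0 ⇒ V x ≠ 0`, so `⟨x, Vᴴ Δ V x⟩ = ⟨Vx, Δ Vx⟩ > 0`). [cite: Petz2008, §11.2] -/
theorem posDef_conjTranspose_mul_mul_of_isometry (V : Matrix N M 𝕜) (hV : Vᴴ * V = 1)
    {Δ : Matrix N N 𝕜} (hΔ : Δ.PosDef) : (Vᴴ * Δ * V).PosDef :=
  hΔ.conjTranspose_mul_mul_same (mulVec_injective_of_isometry V hV)

/-- **Quadratic-form corollary**: for an isometry `V`, a positive definite `Δ` and any vector `ξ`,
`Re ⟨V ξ, (log Δ) V ξ⟩ ≤ Re ⟨ξ, log (Vᴴ Δ V) ξ⟩` — the form in which Jensen's operator inequality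
enters the monotonicity proof (`⟨ρ^{1/2}, f(Δ) ρ^{1/2}⟩` with `V ρ₀^{1/2} = ρ^{1/2}`).
[cite: Petz2008, Theorem 3.10 (last display of the proof)] -/
theorem re_star_dotProduct_log_mulVec_le (V : Matrix N M ℂ) (hV : Vᴴ * V = 1)
    {Δ : Matrix N N ℂ} (hΔ : Δ.PosDef) (ξ : M → ℂ) :
    (star (V *ᵥ ξ) ⬝ᵥ (cfc Real.log Δ *ᵥ (V *ᵥ ξ))).re ≤
      (star ξ ⬝ᵥ (cfc Real.log (Vᴴ * Δ * V) *ᵥ ξ)).re := by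
  have h := (posSemidef_log_sub_conjTranspose_mul_log_mul V hV hΔ).dotProduct_mulVec_nonneg ξ
  have hre := (RCLike.nonneg_iff.mp h).1
  rw [Matrix.sub_mulVec, dotProduct_sub, map_sub] at hre
  have hid : star (V *ᵥ ξ) ⬝ᵥ (cfc Real.log Δ *ᵥ (V *ᵥ ξ)) =
      star ξ ⬝ᵥ ((Vᴴ * cfc Real.log Δ * V) *ᵥ ξ) := by
    rw [star_mulVec, ← dotProduct_mulVec, Matrix.mulVec_mulVec, Matrix.mulVec_mulVec]
  rw [hid]
  simpa using hre

end Literature.LinearAlgebra.Matrix
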